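import Literature.Analysis.FluidPDE.OnsagerBDSVTransportSplit
import Literature.Analysis.FluidPDE.OnsagerBDSVMaterialLeibniz
import Literature.Analysis.FluidPDE.OnsagerBDSVNashErrorProof
import Literature.Analysis.FluidPDE.OnsagerBDSVTildeRTransportProofs
import Literature.Analysis.FunctionSpaces.TorusInverseLaplacianCalculus
import Literature.Analysis.FunctionSpaces.TorusSpaceTimeComposition
import HarnessLib

/-!
# De Rosa's perturbation stage: the transport term in curl form (identities)

L. De Rosa, *Infinitely many Leray–Hopf solutions for the fractional Navier–Stokes equations*,
Comm. PDE 44 (2019) = arXiv:1801.10235, takes the estimate of the transport error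
`ℛ(∂ₜw_{q+1} + (v̄_q·∇)w_{q+1})` of the new Reynolds stress from Buckmaster–De Lellis–Székelyhidi–
Vicol, *Onsager's conjecture for admissible weak solutions*, CPAM 72 (2019) = arXiv:1701.08678,
§6.1.2 (Prop. 5.13 for `R̊^E`: "can be found in [BDLSV2017]"). The tree's BDSV files leave this
estimate open (`OnsagerBDSVTransportSplit.lean`, "What is not here"). This file begins a proof by
the Calderón–Zygmund route that the curl form of the perturbation (arXiv (5.28):
`w_{q+1} = n⁻¹ curl Z`, `BDSV.perturbation`) makes available, exactly as the tree's proof of the Nash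
error (`OnsagerBDSVNashErrorProof.lean`): with `D_t = ∂ₜ + v̄·∇` and `div v̄ = 0`,

  `D_t (curl Z) = curl (D_t Z) - div 𝒞`,   `𝒞_{·l} = ∇v̄_l × Z`
  (`(𝒞 x l)_i = Σ_{j,k} ε_{ijk} (∂_j v̄_l) Z_k`, `BDSV` column convention `div 𝒞 = Σ_l ∂_l 𝒞_{·l}`),

because the commutator `[v̄·∇, curl] Z = -ε_{ijk}(∂_j v̄_l)(∂_l Z_k)` is the divergence of `𝒞` up to the
term `ε_{ijk} ∂_j(div v̄) Z_k = 0`. Hence `ℛ(D_t w_{q+1}) = n⁻¹ (ℛ curl (D_t Z) - ℛ div 𝒞)` with the two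
ORDER-ZERO Calderón–Zygmund operators `ℛ curl`, `ℛ div` (BDSV §4.4, Prop. C.1; the tree's proved
`BDSV.holderCZBound_holds`), and the transport error is bounded by `n⁻¹(‖D_t Z‖_α + ‖∇v̄‖_α ‖Z‖_α)`;
the smallness `‖D_t Z‖₀ ≲ δ_{q+1}^{1/2} τ_q⁻¹` comes from `D_t Φ_i = 0` (the phase of the Mikado flows
is transported exactly, BDSV §5.2) — see `DeRosaPertTransportEnvelope.lean`.

Contents (all `[folklore]` calculus on `[0,T] × T³`, no hypotheses of the scheme):

* `DeRosa.advectiveDeriv_partialDeriv`: **`D_t ∂_k f = ∂_k D_t f - Σ_l (∂_k v_l) ∂_l f`**;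
* `DeRosa.transportTensor v Z` (the tensor `𝒞`), its smoothness and its `C^{0,r}` norm from pointwise
  data (`Torus.eContDiffHolderNorm_transportTensor_le`, the product rule (A.2));
* `DeRosa.advectiveDeriv_curl`: **`D_t (curl Z) = curl (D_t Z) - div 𝒞`** for `div v = 0`.

## References

* L. De Rosa, Comm. PDE 44 (2019) 335–365 = arXiv:1801.10235, §5.5 Prop. 5.13 (`R̊^E`).
* T. Buckmaster, C. De Lellis, L. Székelyhidi Jr., V. Vicol, CPAM 72 (2019) = arXiv:1701.08678,
  §6.1.2 (arXiv (6.6)–(6.8)), §5.3 (5.28), §4.4, App. C Prop. C.1.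
-/

open MeasureTheory Set
open scoped NNReal ENNReal ContDiff Matrix Matrix.Norms.Elementwise

noncomputable section

namespace Literature.Analysis.FluidPDE

namespace DeRosa

open BDSV FunctionSpaces FunctionSpaces.Torus

/-- The flat three-torus `T³ = (ℝ/ℤ)³`, local notation. -/
local notation "𝕋³" => UnitAddTorus (Fin 3)

/-- Euclidean `ℝ³`, local notation. -/
local notation "ℝ³" => EuclideanSpace ℝ (Fin 3)

/-! ## `D_t ∂_k = ∂_k D_t - (∂_k v_l) ∂_l` -/

section Commutator

variable {F : Type*} [NormedAddCommGroup F] [NormedSpace ℝ F] {T : ℝ} {v : ℝ → 𝕋³ → ℝ³}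
  {f : ℝ → 𝕋³ → F}

/-- A partial derivative through a continuous linear map. [folklore] -/
theorem partialDeriv_clm_apply {G : Type*} [NormedAddCommGroup G] [NormedSpace ℝ G]
    (L : F →L[ℝ] G) {g : 𝕋³ → F} (hg : IsContDiff 1 g) (j : Fin 3) (x : 𝕋³) :
    Torus.partialDeriv j (fun y => L (g y)) x = L (Torus.partialDeriv j g x) := by
  have hLg : IsContDiff 1 (fun y => L (g y)) := L.contDiff.comp hg
  rw [partialDeriv_eq_fderiv_apply hLg, partialDeriv_eq_fderiv_apply hg]
  unfold Torus.fderiv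
  have e : liftAt (fun y => L (g y)) x = fun z => L (liftAt g x z) := rfl
  have hd : DifferentiableAt ℝ (liftAt g x) 0 :=
    ((hg.liftAt x).differentiable one_ne_zero).differentiableAt
  have h2 : HasFDerivAt (fun z => L (liftAt g x z)) (L.comp (_root_.fderiv ℝ (liftAt g x) 0)) 0 :=
    L.hasFDerivAt.comp (0 : EuclideanSpace ℝ (Fin 3)) hd.hasFDerivAt
  rw [e, h2.fderiv]
  rfl

/-- **The commutator of the transport derivative with a partial derivative**: for jointly smooth
`v`, `f` on `[0,T] × T³` (`T > 0`),
`(∂ₜ + v·∇)(∂_k f) = ∂_k ((∂ₜ + v·∇) f) - Σ_l (∂_k v)_l ∂_l f` at every `(t, x)`, `t ∈ [0,T]`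
(`∂ₜ∂_k = ∂_k∂ₜ`, `∂_k∂_l = ∂_l∂_k` and the Leibniz rule). [folklore] -/
theorem advectiveDeriv_partialDeriv (hT : 0 < T) (hv : Torus.IsSmoothSpaceTimeOn (Icc 0 T) v)
    (hf : Torus.IsSmoothSpaceTimeOn (Icc 0 T) f) {t : ℝ} (ht : t ∈ Icc 0 T) (k : Fin 3) (x : 𝕋³) :
    advectiveDeriv T v (fun s y => Torus.partialDeriv k (f s) y) t x =
      Torus.partialDeriv k (advectiveDeriv T v f t) x -
        ∑ l, Torus.partialDeriv k (v t) x l • Torus.partialDeriv l (f t) x := by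
  have hU : UniqueDiffOn ℝ (Icc 0 T) := uniqueDiffOn_Icc hT
  have hft : IsSmooth (f t) := hf.isSmooth_slice ht
  have hvt : IsSmooth (v t) := hv.isSmooth_slice ht
  have hf1 : IsContDiff 1 (f t) := hft.isContDiff (by simp)
  have hv1 : IsContDiff 1 (v t) := hvt.isContDiff (by simp)
  have hdf : ∀ l, IsSmooth (Torus.partialDeriv l (f t)) := fun l => hft.partialDeriv l
  have hdf1 : ∀ l, IsContDiff 1 (Torus.partialDeriv l (f t)) := fun l => (hdf l).isContDiff (by simp)
  have hvl1 : ∀ l, IsContDiff 1 (fun y => v t y l) := fun l => (hvt.apply l).isContDiff (by simp)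
  -- the time derivative of the slice and its smoothness
  set g : 𝕋³ → F := Torus.timeDerivWithin (Icc 0 T) f t with hg
  have hgs : IsSmooth g := (hf.timeDerivWithin hU).isSmooth_slice ht
  have hg1 : IsContDiff 1 g := hgs.isContDiff (by simp)
  -- left-hand side
  have hL : advectiveDeriv T v (fun s y => Torus.partialDeriv k (f s) y) t x =
      Torus.partialDeriv k g x + ∑ l, v t x l • Torus.partialDeriv l (Torus.partialDeriv k (f t)) x := by
    rw [advectiveDeriv_apply]
    congr 1
    · exact timeDerivWithin_partialDeriv_comm hT hf ht k x
    · exact convect_eq_sum_smul_partialDeriv (u := v t) (hdf1 k) x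
  -- the field `D_t f (t, ·)` and its partial derivative
  have hD : advectiveDeriv T v f t = fun y => g y + ∑ l, v t y l • Torus.partialDeriv l (f t) y := by
    funext y
    rw [advectiveDeriv_apply]
    congr 1
    exact convect_eq_sum_smul_partialDeriv (u := v t) hf1 y
  have hterm : ∀ l ∈ (Finset.univ : Finset (Fin 3)),
      IsContDiff 1 (fun y => v t y l • Torus.partialDeriv l (f t) y) := fun l _ =>
    ContDiff.smul (hvl1 l) (hdf1 l)
  have hsum1 : IsContDiff 1 (fun y => ∑ l, v t y l • Torus.partialDeriv l (f t) y) := by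
    have h : ContDiff ℝ 1 fun z : EuclideanSpace ℝ (Fin 3) =>
        ∑ l ∈ (Finset.univ : Finset (Fin 3)), lift (fun y => v t y l • Torus.partialDeriv l (f t) y) z :=
      ContDiff.sum fun l hl => hterm l hl
    exact h
  have hR : Torus.partialDeriv k (advectiveDeriv T v f t) x =
      Torus.partialDeriv k g x + ∑ l, (v t x l • Torus.partialDeriv k (Torus.partialDeriv l (f t)) x +
        Torus.partialDeriv k (v t) x l • Torus.partialDeriv l (f t) x) := by
    rw [hD]
    have e : (fun y => g y + ∑ l, v t y l • Torus.partialDeriv l (f t) y) =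
        g + fun y => ∑ l, v t y l • Torus.partialDeriv l (f t) y := rfl
    rw [e, partialDeriv_add hg1 hsum1, Pi.add_apply]
    congr 1
    rw [show (fun y => ∑ l, v t y l • Torus.partialDeriv l (f t) y) =
        fun y => ∑ l ∈ Finset.univ, v t y l • Torus.partialDeriv l (f t) y from rfl,
      partialDeriv_finset_sum Finset.univ hterm]
    refine Finset.sum_congr rfl fun l _ => ?_
    rw [partialDeriv_smul (hvl1 l) (hdf1 l), partialDeriv_apply_coord hv1]
  rw [hL, hR, add_sub_assoc]
  congr 1
  rw [← Finset.sum_sub_distrib]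
  refine Finset.sum_congr rfl fun l _ => ?_
  rw [partialDeriv_comm hft k l x]
  abel

end Commutator

/-! ## The tensor `𝒞_{·l} = ∇v_l × Z` -/

section Tensor

/-- **The transport commutator tensor** `𝒞 = 𝒞(v, Z)`: column `l` is `∇v_l × Z`, i.e.
`(𝒞 x l)_i = Σ_{j,k} ε_{ijk} (∂_j v)_l (x) Z_k(x)` — the curl combination (`BDSV.curlMatrix`) of the
matrix `(∂_j v_l · Z_k)_{jk}`. [folklore] -/
def transportTensor (v Z : 𝕋³ → ℝ³) (x : 𝕋³) (l : Fin 3) : ℝ³ :=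
  curlMatrix fun j k => Torus.partialDeriv j v x l * Z x k

/-- The matrix `(∂_j v_l · Z_k)_{jk}` behind column `l` of `𝒞`. [folklore] -/
def transportMatrix (v Z : 𝕋³ → ℝ³) (l : Fin 3) (x : 𝕋³) : Fin 3 → Fin 3 → ℝ :=
  fun j k => Torus.partialDeriv j v x l * Z x k

/-- Column `l` of `𝒞` is `curlMatrix` of the matrix function. [folklore] -/
theorem transportTensor_eq (v Z : 𝕋³ → ℝ³) (l : Fin 3) :
    (fun x => transportTensor v Z x l) = fun x => curlMatrix (transportMatrix v Z l x) := rfl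

variable {v Z : 𝕋³ → ℝ³}

/-- The entries `∂_j v_l · Z_k` are `C¹` (indeed smooth) for smooth `v, Z`. [folklore] -/
theorem isSmooth_transportMatrix_entry (hv : IsSmooth v) (hZ : IsSmooth Z) (l j k : Fin 3) :
    IsSmooth (fun x => Torus.partialDeriv j v x l * Z x k) :=
  ((hv.partialDeriv j).apply l).mul (hZ.apply k)

/-- The matrix function `(∂_j v_l · Z_k)_{jk}` is smooth. [folklore] -/
theorem isSmooth_transportMatrix (hv : IsSmooth v) (hZ : IsSmooth Z) (l : Fin 3) :
    IsSmooth (transportMatrix v Z l) := by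
  unfold IsSmooth
  rw [contDiff_pi]
  intro j
  rw [contDiff_pi]
  intro k
  exact isSmooth_transportMatrix_entry hv hZ l j k

/-- The tensor `𝒞` is smooth for smooth `v, Z`. [folklore] -/
theorem isSmooth_transportTensor (hv : IsSmooth v) (hZ : IsSmooth Z) :
    IsSmooth (transportTensor v Z) := by
  refine contDiff_pi.2 fun l => ?_
  have h' : (fun y => lift (transportTensor v Z) y l) = lift (fun y => transportTensor v Z y l) := rfl
  rw [h', transportTensor_eq]
  exact (isSmooth_transportMatrix hv hZ l).comp_clm curlMatrix

/-- **`div 𝒞 = curlMatrix (Σ_l (∂_j v_l)(∂_l Z_k))_{jk}` when `div v = 0`**: in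
`∂_l (∂_j v_l · Z_k) = (∂_l∂_j v_l) Z_k + (∂_j v_l)(∂_l Z_k)` the first terms sum over `l` to
`∂_j (div v) Z_k = 0`. [folklore] -/
theorem tensorDivergence_transportTensor (hv : IsSmooth v) (hZ : IsSmooth Z)
    (hdiv : ∀ x, Torus.divergence v x = 0) (x : 𝕋³) :
    Torus.tensorDivergence (transportTensor v Z) x =
      curlMatrix fun j k => ∑ l, Torus.partialDeriv j v x l * Torus.partialDeriv l Z x k := by
  have hv1 : IsContDiff 1 v := hv.isContDiff (by simp)
  have hZ1 : IsContDiff 1 Z := hZ.isContDiff (by simp)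
  have hvl : ∀ l, IsSmooth (fun y => v y l) := fun l => hv.apply l
  have hdv1 : ∀ j l, IsContDiff 1 (fun y => Torus.partialDeriv j v y l) := fun j l =>
    ((hv.partialDeriv j).apply l).isContDiff (by simp)
  have hZk1 : ∀ k, IsContDiff 1 (fun y => Z y k) := fun k => (hZ.apply k).isContDiff (by simp)
  have hM1 : ∀ l, IsContDiff 1 (transportMatrix v Z l) := fun l =>
    (isSmooth_transportMatrix hv hZ l).isContDiff (by simp)
  -- `∂_l` of column `l`
  have hcol : ∀ l, Torus.partialDeriv l (fun y => transportTensor v Z y l) x =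
      curlMatrix fun j k => Torus.partialDeriv l (Torus.partialDeriv j v) x l * Z x k +
        Torus.partialDeriv j v x l * Torus.partialDeriv l Z x k := by
    intro l
    rw [transportTensor_eq, partialDeriv_clm_apply curlMatrix (hM1 l) l x]
    congr 1
    funext j k
    have e1 : Torus.partialDeriv l (transportMatrix v Z l) x j k =
        Torus.partialDeriv l (fun y => transportMatrix v Z l y j k) x := by
      have h := partialDeriv_clm_apply (matrixEntry j k) (hM1 l) l x
      rw [matrixEntry_apply] at h
      rw [← h]
      rfl
    rw [e1]
    show Torus.partialDeriv l (fun y => Torus.partialDeriv j v y l * Z y k) x = _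
    have hprod := partialDeriv_smul (F := ℝ) (hdv1 j l) (hZk1 k) l x
    simp only [smul_eq_mul] at hprod
    rw [hprod, partialDeriv_apply_coord hZ1, partialDeriv_apply_coord ((hv.partialDeriv j).isContDiff (by simp))]
    ring
  -- `Σ_l ∂_l∂_j v_l = ∂_j div v = 0`
  have hdivj : ∀ j, ∑ l, Torus.partialDeriv l (Torus.partialDeriv j v) x l = 0 := by
    intro j
    have h0 : Torus.partialDeriv j (Torus.divergence v) x = 0 := by
      have e : Torus.divergence v = fun _ => (0 : ℝ) := funext hdiv
      rw [e]
      simp [Torus.partialDeriv, Torus.lineDeriv]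
    have e : Torus.divergence v = fun y => ∑ l ∈ Finset.univ, Torus.partialDeriv l (fun z => v z l) y := by
      funext y; rfl
    rw [e, partialDeriv_finset_sum Finset.univ (fun l _ => ((hvl l).partialDeriv l).isContDiff (by simp))] at h0
    rw [← h0]
    refine Finset.sum_congr rfl fun l _ => ?_
    have e2 : Torus.partialDeriv l (fun z => v z l) = fun y => Torus.partialDeriv l v y l :=
      funext fun y => partialDeriv_apply_coord hv1 l y l
    rw [e2, partialDeriv_apply_coord ((hv.partialDeriv l).isContDiff (by simp)),
      partialDeriv_comm hv j l x]
  rw [Torus.tensorDivergence]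
  simp_rw [hcol]
  rw [← map_sum]
  congr 1
  funext j k
  simp only [Finset.sum_apply, Finset.sum_add_distrib, ← Finset.sum_mul, hdivj j, zero_mul, zero_add]

end Tensor

/-! ## `D_t (curl Z) = curl (D_t Z) - div 𝒞` -/

section CurlCommutator

variable {T : ℝ} {v : ℝ → 𝕋³ → ℝ³} {Z : ℝ → 𝕋³ → ℝ³}

/-- The Jacobian field `(∂_j Z_k)_{jk}` is jointly smooth. [folklore] -/
theorem isSmoothSpaceTimeOn_jacobian (hT : 0 < T) (hZ : Torus.IsSmoothSpaceTimeOn (Icc 0 T) Z) :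
    Torus.IsSmoothSpaceTimeOn (Icc 0 T) (fun s y => jacobian (Z s) y) := by
  rw [Torus.isSmoothSpaceTimeOn_pi]
  intro j
  rw [Torus.isSmoothSpaceTimeOn_pi]
  intro k
  exact (hZ.partialDeriv (uniqueDiffOn_Icc hT) j).apply k

/-- **The transport derivative of a curl**: for jointly smooth `v, Z` on `[0,T] × T³` with
`div v(t, ·) = 0`,
`(∂ₜ + v·∇)(curl Z) = curl ((∂ₜ + v·∇) Z) - div 𝒞(v, Z)` at `(t, x)`. [folklore] -/
theorem advectiveDeriv_curl (hT : 0 < T) (hv : Torus.IsSmoothSpaceTimeOn (Icc 0 T) v)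
    (hZ : Torus.IsSmoothSpaceTimeOn (Icc 0 T) Z) {t : ℝ} (ht : t ∈ Icc 0 T)
    (hdiv : ∀ x, Torus.divergence (v t) x = 0) (x : 𝕋³) :
    advectiveDeriv T v (fun s y => BDSV.curl (Z s) y) t x =
      BDSV.curl (advectiveDeriv T v Z t) x -
        Torus.tensorDivergence (transportTensor (v t) (Z t)) x := by
  have hJ := isSmoothSpaceTimeOn_jacobian hT hZ
  have hvt : IsSmooth (v t) := hv.isSmooth_slice ht
  have hZt : IsSmooth (Z t) := hZ.isSmooth_slice ht
  -- `curl Z = curlMatrix ∘ jacobian Z`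
  have e : (fun s y => BDSV.curl (Z s) y) = fun s y => curlMatrix (jacobian (Z s) y) := rfl
  rw [e, advectiveDeriv_clm_apply (v := v) hT hJ curlMatrix ht x, tensorDivergence_transportTensor hvt hZt hdiv x,
    curl_eq_curlMatrix_jacobian, ← map_sub]
  congr 1
  funext j k
  -- the `(j,k)` entry of `D_t (jacobian Z)` is `D_t (∂_j Z_k)`
  have hjk : advectiveDeriv T v (fun s y => jacobian (Z s) y) t x j k =
      advectiveDeriv T v (fun s y => Torus.partialDeriv j (Z s) y k) t x := by
    have h := advectiveDeriv_clm_apply (v := v) hT hJ (matrixEntry j k) ht x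
    rw [matrixEntry_apply] at h
    rw [← h]
    rfl
  have hk : advectiveDeriv T v (fun s y => Torus.partialDeriv j (Z s) y k) t x =
      advectiveDeriv T v (fun s y => Torus.partialDeriv j (Z s) y) t x k := by
    have h := advectiveDeriv_clm_apply (v := v) hT (hZ.partialDeriv (uniqueDiffOn_Icc hT) j)
      (EuclideanSpace.proj k) ht x
    exact h
  rw [hjk, hk, advectiveDeriv_partialDeriv hT hv hZ ht j x]
  simp only [Pi.sub_apply, PiLp.sub_apply, jacobian, WithLp.ofLp_sum, Finset.sum_apply, PiLp.smul_apply,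
    smul_eq_mul]

end CurlCommutator

/-! ## `D_t Σ = Σ D_t` -/

section Sum

variable {F : Type*} [NormedAddCommGroup F] [NormedSpace ℝ F] {T : ℝ} {v : ℝ → 𝕋³ → ℝ³}

/-- The transport derivative of a finite sum of jointly smooth fields. [folklore] -/
theorem advectiveDeriv_finset_sum (hT : 0 < T) {ι : Type*} (s : Finset ι) {f : ι → ℝ → 𝕋³ → F}
    (hf : ∀ i ∈ s, Torus.IsSmoothSpaceTimeOn (Icc 0 T) (f i)) {t : ℝ} (ht : t ∈ Icc 0 T) (x : 𝕋³) :
    advectiveDeriv T v (fun s' y => ∑ i ∈ s, f i s' y) t x = ∑ i ∈ s, advectiveDeriv T v (f i) t x := by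
  classical
  induction s using Finset.induction_on with
  | empty =>
    simp only [Finset.sum_empty]
    rw [advectiveDeriv_apply]
    show derivWithin (fun _ : ℝ => (0 : F)) (Icc 0 T) t +
      _root_.fderiv ℝ (fun _ : EuclideanSpace ℝ (Fin 3) => (0 : F)) 0 (v t x) = 0
    simp
  | @insert a s ha ih =>
    have hfs : Torus.IsSmoothSpaceTimeOn (Icc 0 T) (fun s' y => ∑ i ∈ s, f i s' y) :=
      Torus.IsSmoothSpaceTimeOn.sum fun i hi => hf i (Finset.mem_insert_of_mem hi)
    have hfa : Torus.IsSmoothSpaceTimeOn (Icc 0 T) (f a) := hf a (Finset.mem_insert_self a s)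
    simp only [Finset.sum_insert ha]
    rw [advectiveDeriv_add_apply hT hfa hfs ht x, ih fun i hi => hf i (Finset.mem_insert_of_mem hi)]

end Sum

/-! ## The Mikado factor is transported: `D_t [V(R̃, nΦ)] = (∂_R V)(R̃, nΦ)[D_t R̃]` -/

section Mikado

/-- Real `3 × 3` matrices (elementwise norm), local notation. -/
local notation "𝕄" => Matrix (Fin 3) (Fin 3) ℝ

variable {T : ℝ} {v : ℝ → 𝕋³ → ℝ³}

/-- **The Mikado composite is transported along the flow** (BDSV §5.2: `Φ_i` solves
`(∂ₜ + v̄_q·∇)Φ_i = 0`, so that in `D_t[V(R̃, nΦ_i)]` only the slow argument `R̃` is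
differentiated): for a jointly smooth matrix field `R`, a displacement `d` with
`∂ₜ d + (v·∇) d + v = 0` at `(t, x)`, a profile `V` with smooth lift and `n ∈ ℕ`,
`(∂ₜ + v·∇)[V(R, n(x + d))] (t,x) = ∂_R V(R(t,x), n(x + d(t,x)))[(∂ₜ + v·∇)R (t,x)]`.
[cite: BuckmasterEtAl2018, §5.2 (transport of Φ_i) and §6.1.2 (arXiv (6.6): D_t W(R̃, λΦ))] -/
theorem advectiveDeriv_mikado (hT : 0 < T) {R : ℝ → 𝕋³ → 𝕄} {d : ℝ → 𝕋³ → ℝ³}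
    (hR : Torus.IsSmoothSpaceTimeOn (Icc 0 T) R) (hd : Torus.IsSmoothSpaceTimeOn (Icc 0 T) d)
    {V : 𝕄 → 𝕋³ → ℝ³} (hV : ContDiff ℝ ∞ (mikadoLift V)) (n : ℕ) {t : ℝ} (ht : t ∈ Icc 0 T)
    (x : 𝕋³) (htr : Torus.timeDerivWithin (Icc 0 T) d t x + Torus.convect (v t) (d t) x + v t x = 0) :
    advectiveDeriv T v (fun s y => V (R s y) (n • (y + proj (d s y)))) t x =
      (fderiv ℝ (fun M => V M (n • (x + proj (d t x)))) (R t x)) (advectiveDeriv T v R t x) := by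
  obtain ⟨y, rfl⟩ := proj_surjective x
  -- the phase in lifted form
  have hph : ∀ (e z : ℝ³), (n • (proj z + proj e) : 𝕋³) = proj ((n : ℝ) • (z + e)) := fun e z => by
    rw [← proj_add, Nat.cast_smul_eq_nsmul, proj_nsmul]
  set ξ : ℝ³ := (n : ℝ) • (y + d t (proj y)) with hξ
  set p : 𝕄 × ℝ³ := (R t (proj y), ξ) with hp
  have hVd : HasFDerivAt (mikadoLift V) (fderiv ℝ (mikadoLift V) p) p :=
    ((hV.differentiable (by simp)) p).hasFDerivAt
  -- ### the time derivative
  have htime : Torus.timeDerivWithin (Icc 0 T) (fun s y' => V (R s y') (n • (y' + proj (d s y')))) t (proj y) =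
      fderiv ℝ (mikadoLift V) p (Torus.timeDerivWithin (Icc 0 T) R t (proj y),
        (n : ℝ) • Torus.timeDerivWithin (Icc 0 T) d t (proj y)) := by
    unfold Torus.timeDerivWithin
    have e : (fun s => V (R s (proj y)) (n • (proj y + proj (d s (proj y))))) =
        fun s => mikadoLift V (R s (proj y), (n : ℝ) • (y + d s (proj y))) := by
      funext s
      rw [mikadoLift_apply, hph]
    show derivWithin (fun s => V (R s (proj y)) (n • (proj y + proj (d s (proj y))))) (Icc 0 T) t = _
    rw [e]
    have hin : HasDerivWithinAt (fun s => (R s (proj y), (n : ℝ) • (y + d s (proj y))))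
        (derivWithin (fun s => R s (proj y)) (Icc 0 T) t,
          (n : ℝ) • derivWithin (fun s => d s (proj y)) (Icc 0 T) t) (Icc 0 T) t :=
      (hR.hasDerivWithinAt_slice ht (proj y)).prodMk
        (((hd.hasDerivWithinAt_slice ht (proj y)).const_add y).const_smul (n : ℝ))
    have hpt : (R t (proj y), (n : ℝ) • (y + d t (proj y))) = p := rfl
    have hVd' : HasFDerivAt (mikadoLift V) (fderiv ℝ (mikadoLift V) p)
        (R t (proj y), (n : ℝ) • (y + d t (proj y))) := hVd
    exact (hVd'.comp_hasDerivWithinAt t hin).derivWithin (uniqueDiffOn_Icc hT t ht)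
  -- ### the space derivative
  have hspace : Torus.fderiv (fun y' => V (R t y') (n • (y' + proj (d t y')))) (proj y) (v t (proj y)) =
      fderiv ℝ (mikadoLift V) p (Torus.fderiv (R t) (proj y) (v t (proj y)),
        (n : ℝ) • (v t (proj y) + Torus.fderiv (d t) (proj y) (v t (proj y)))) := by
    unfold Torus.fderiv
    have e : liftAt (fun y' => V (R t y') (n • (y' + proj (d t y')))) (proj y) =
        fun z => mikadoLift V (liftAt (R t) (proj y) z, (n : ℝ) • ((y + z) + liftAt (d t) (proj y) z)) := by
      funext z
      rw [liftAt_apply, mikadoLift_apply, liftAt_apply, liftAt_apply, ← proj_add, hph]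
    rw [e]
    have h1 := hasFDerivAt_liftAt (hR.isSmooth_slice ht) (proj y)
    have h2 := hasFDerivAt_liftAt (hd.isSmooth_slice ht) (proj y)
    have hin : HasFDerivAt (fun z : ℝ³ => (liftAt (R t) (proj y) z, (n : ℝ) • ((y + z) + liftAt (d t) (proj y) z)))
        ((_root_.fderiv ℝ (liftAt (R t) (proj y)) 0).prod
          ((n : ℝ) • (ContinuousLinearMap.id ℝ ℝ³ + _root_.fderiv ℝ (liftAt (d t) (proj y)) 0))) 0 :=
      h1.prodMk ((((hasFDerivAt_id (0 : ℝ³)).const_add y).add h2).const_smul (n : ℝ))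
    have hpt : (liftAt (R t) (proj y) 0, (n : ℝ) • ((y + 0) + liftAt (d t) (proj y) 0)) = p := by
      rw [liftAt_apply_zero, liftAt_apply_zero, add_zero]
    have hVd' : HasFDerivAt (mikadoLift V) (fderiv ℝ (mikadoLift V) p)
        (liftAt (R t) (proj y) 0, (n : ℝ) • ((y + 0) + liftAt (d t) (proj y) 0)) := by
      rw [hpt]; exact hVd
    have hcomp : HasFDerivAt
        (fun z : ℝ³ => mikadoLift V (liftAt (R t) (proj y) z, (n : ℝ) • ((y + z) + liftAt (d t) (proj y) z)))
        ((_root_.fderiv ℝ (mikadoLift V) p).comp ((_root_.fderiv ℝ (liftAt (R t) (proj y)) 0).prod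
          ((n : ℝ) • (ContinuousLinearMap.id ℝ ℝ³ + _root_.fderiv ℝ (liftAt (d t) (proj y)) 0)))) 0 :=
      (hVd'.comp (0 : ℝ³) hin :)
    rw [hcomp.fderiv]
    rfl
  -- ### the sum, and the transport of the phase
  have hsum : advectiveDeriv T v (fun s y' => V (R s y') (n • (y' + proj (d s y')))) t (proj y) =
      fderiv ℝ (mikadoLift V) p (advectiveDeriv T v R t (proj y), 0) := by
    rw [advectiveDeriv_apply, htime, hspace, ← map_add, Prod.mk_add_mk, ← smul_add, advectiveDeriv_apply]
    congr 2
    have e : Torus.timeDerivWithin (Icc 0 T) d t (proj y) +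
        (v t (proj y) + Torus.fderiv (d t) (proj y) (v t (proj y))) =
        Torus.timeDerivWithin (Icc 0 T) d t (proj y) + Torus.convect (v t) (d t) (proj y) + v t (proj y) := by
      rw [Torus.convect]; abel
    rw [e, htr, smul_zero]
  rw [hsum]
  -- ### the partial derivative in `R`
  have e : (fun M => V M (n • (proj y + proj (d t (proj y))))) = fun M => mikadoLift V (M, ξ) := by
    funext M
    rw [mikadoLift_apply, hph]
  rw [e]
  have hinl : HasFDerivAt (fun M : 𝕄 => (M, ξ)) (ContinuousLinearMap.inl ℝ 𝕄 ℝ³) (R t (proj y)) :=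
    hasFDerivAt_prodMk_left (𝕜 := ℝ) (R t (proj y)) ξ
  have hcomp : HasFDerivAt (fun M : 𝕄 => mikadoLift V (M, ξ))
      ((_root_.fderiv ℝ (mikadoLift V) p).comp (ContinuousLinearMap.inl ℝ 𝕄 ℝ³)) (R t (proj y)) :=
    (hVd.comp (R t (proj y)) hinl :)
  rw [hcomp.fderiv]
  rfl

end Mikado

/-! ## `D_t` of the potential summand: the three-term formula -/

section Summand

/-- Real `3 × 3` matrices (elementwise norm), local notation. -/
local notation "𝕄" => Matrix (Fin 3) (Fin 3) ℝ

variable {P : Params} {S : Setting} {η : ℕ → ℝ → 𝕋³ → ℝ} {D : ℕ → ℝ → 𝕋³ → ℝ³}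

/-- The Mikado factor of the `i`-th summand, `V(R̃_{q,i}, n_{q+1}Φ_i)`. [cite: BuckmasterEtAl2018, §5.3 (5.28)] -/
def mikadoFactor (P : Params) (S : Setting) (𝔚 : MikadoDatum mikadoRadius) (η : ℕ → ℝ → 𝕋³ → ℝ)
    (D : ℕ → ℝ → 𝕋³ → ℝ³) (i : ℕ) (t : ℝ) (x : 𝕋³) : ℝ³ :=
  𝔚.V (tildeR P S η D i t x) (P.freqNat (S.q + 1) • phiPoint D i t x)

/-- `∂_R V(R̃_{q,i}, n_{q+1}Φ_i)[M]`, the derivative of the Mikado profile in its matrix argument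
at the point of the `i`-th summand. [cite: BuckmasterEtAl2018, §6.1.2 (arXiv (6.6))] -/
def mikadoRDeriv (P : Params) (S : Setting) (𝔚 : MikadoDatum mikadoRadius) (η : ℕ → ℝ → 𝕋³ → ℝ)
    (D : ℕ → ℝ → 𝕋³ → ℝ³) (i : ℕ) (t : ℝ) (x : 𝕋³) (M : 𝕄) : ℝ³ :=
  (fderiv ℝ (fun R' => 𝔚.V R' (P.freqNat (S.q + 1) • phiPoint D i t x)) (tildeR P S η D i t x)) M

/-- The `i`-th summand is `ρ_{q,i}^{1/2} • bmat (∇Φ_i) (V(R̃_{q,i}, n_{q+1}Φ_i))`. [folklore] -/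
theorem potentialSummand_eq (𝔚 : MikadoDatum mikadoRadius) (i : ℕ) (t : ℝ) (x : 𝕋³) :
    potentialSummand P S 𝔚 η D i t x =
      sqrtRhoI P S η i t x • bmat (gradPhi D i t x) (mikadoFactor P S 𝔚 η D i t x) := rfl

/-- `∇Φ_i` is jointly smooth as a matrix field (elementwise norm). [folklore] -/
theorem _root_.Literature.Analysis.FluidPDE.BDSV.SmoothData.gradPhi (h : SmoothData P S η D) (i : ℕ) :
    Torus.IsSmoothSpaceTimeOn (Icc 0 S.T) (gradPhi D i) :=
  contDiffOn_pi' fun a => contDiffOn_pi' fun b => isSmoothSpaceTimeOn_gradPhi h.pos_T h.disp i a b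

/-- `R̃_{q,i}` is jointly smooth as a matrix field (elementwise norm). [folklore] -/
theorem _root_.Literature.Analysis.FluidPDE.BDSV.SmoothData.tildeR (h : SmoothData P S η D) (i : ℕ) :
    Torus.IsSmoothSpaceTimeOn (Icc 0 S.T) (tildeR P S η D i) :=
  contDiffOn_pi' fun a => contDiffOn_pi' fun b =>
    isSmoothSpaceTimeOn_tildeR h.pos_T h.e h.vbar h.Rbar h.eta h.disp (fun t ht => (h.rho_pos t ht).ne') i a b

/-- **`D_t` of the Mikado factor**: `D_t[V(R̃_{q,i}, n_{q+1}Φ_i)] = ∂_R V(…)[D_t R̃_{q,i}]` when `D_i`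
is transported (`∂ₜD_i + (v̄·∇)D_i + v̄ = 0`). [cite: BuckmasterEtAl2018, §6.1.2 (arXiv (6.6))] -/
theorem advectiveDeriv_mikadoFactor (h : SmoothData P S η D) (𝔚 : MikadoDatum mikadoRadius) (i : ℕ)
    {t : ℝ} (ht : t ∈ Icc 0 S.T) (x : 𝕋³)
    (htr : Torus.timeDerivWithin (Icc 0 S.T) (D i) t x + Torus.convect (S.vbar t) (D i t) x + S.vbar t x = 0) :
    advectiveDeriv S.T S.vbar (mikadoFactor P S 𝔚 η D i) t x =
      mikadoRDeriv P S 𝔚 η D i t x (advectiveDeriv S.T S.vbar (tildeR P S η D i) t x) :=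
  advectiveDeriv_mikado h.pos_T (h.tildeR i) (h.disp i) 𝔚.smooth_V _ ht x htr

/-- **The three-term formula** (BDSV §6.1.2, the `D_t w_o` display, for the potential `Z`):
`D_t (ρ_{q,i}^{1/2} ∇Φ_iᵀ V(R̃_{q,i}, nΦ_i)) = (D_t ρ_{q,i}^{1/2}) ∇Φ_iᵀ V + ρ_{q,i}^{1/2} (D_t∇Φ_i)ᵀ V
  + ρ_{q,i}^{1/2} ∇Φ_iᵀ ∂_R V[D_t R̃_{q,i}]` on `[0,T]`, the phase being transported.
[cite: BuckmasterEtAl2018, §6.1.2 (arXiv (6.6)–(6.7))] -/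
theorem advectiveDeriv_potentialSummand (h : SmoothData P S η D) (𝔚 : MikadoDatum mikadoRadius) (i : ℕ)
    {t : ℝ} (ht : t ∈ Icc 0 S.T) (x : 𝕋³)
    (htr : Torus.timeDerivWithin (Icc 0 S.T) (D i) t x + Torus.convect (S.vbar t) (D i t) x + S.vbar t x = 0) :
    advectiveDeriv S.T S.vbar (potentialSummand P S 𝔚 η D i) t x =
      advectiveDeriv S.T S.vbar (sqrtRhoI P S η i) t x •
          bmat (gradPhi D i t x) (mikadoFactor P S 𝔚 η D i t x) +
        sqrtRhoI P S η i t x •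
          (bmat (advectiveDeriv S.T S.vbar (gradPhi D i) t x) (mikadoFactor P S 𝔚 η D i t x) +
            bmat (gradPhi D i t x)
              (mikadoRDeriv P S 𝔚 η D i t x (advectiveDeriv S.T S.vbar (tildeR P S η D i) t x))) := by
  have hT := h.pos_T
  have hσ := h.sqrtRhoI i
  have hG := h.gradPhi i
  have hF : Torus.IsSmoothSpaceTimeOn (Icc 0 S.T) (mikadoFactor P S 𝔚 η D i) := h.mikadoV 𝔚 i
  have hGF : Torus.IsSmoothSpaceTimeOn (Icc 0 S.T) (fun s y => bmat (gradPhi D i s y) (mikadoFactor P S 𝔚 η D i s y)) :=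
    hG.clm_bilinear hF bmat
  have e : potentialSummand P S 𝔚 η D i =
      fun s y => ContinuousLinearMap.lsmul ℝ ℝ (sqrtRhoI P S η i s y)
        (bmat (gradPhi D i s y) (mikadoFactor P S 𝔚 η D i s y)) := rfl
  have h1 := advectiveDeriv_bilinear (v := S.vbar) hT (ContinuousLinearMap.lsmul ℝ ℝ) hσ hGF ht x
  have h2 := advectiveDeriv_bilinear (v := S.vbar) hT bmat hG hF ht x
  have h3 := advectiveDeriv_mikadoFactor h 𝔚 i ht x htr
  rw [e, h1]
  have e2 : advectiveDeriv S.T S.vbar (fun s y => bmat (gradPhi D i s y) (mikadoFactor P S 𝔚 η D i s y)) t x =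
      bmat (advectiveDeriv S.T S.vbar (gradPhi D i) t x) (mikadoFactor P S 𝔚 η D i t x) +
        bmat (gradPhi D i t x) (advectiveDeriv S.T S.vbar (mikadoFactor P S 𝔚 η D i) t x) := h2
  rw [e2, h3]
  rfl

/-- **`D_t Z = Σ_i D_t (i-th summand)`** on `[0,T]`. [folklore] -/
theorem advectiveDeriv_potential (h : SmoothData P S η D) (𝔚 : MikadoDatum mikadoRadius) {t : ℝ}
    (ht : t ∈ Icc 0 S.T) (x : 𝕋³) :
    advectiveDeriv S.T S.vbar (potential P S 𝔚 η D) t x =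
      ∑ i ∈ Finset.range (cutoffCount S.T (P.τ S.q)),
        advectiveDeriv S.T S.vbar (potentialSummand P S 𝔚 η D i) t x := by
  have e : potential P S 𝔚 η D = fun s y => ∑ i ∈ Finset.range (cutoffCount S.T (P.τ S.q)),
      potentialSummand P S 𝔚 η D i s y := by
    funext s y
    exact potential_eq_sum P S 𝔚 η D s y
  rw [e]
  refine advectiveDeriv_finset_sum h.pos_T _ (fun i _ => ?_) ht x
  exact (h.sqrtRhoI i).smul ((h.gradPhi i).clm_bilinear (h.mikadoV 𝔚 i) bmat)

end Summand

end DeRosa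

end Literature.Analysis.FluidPDE
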